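import Mathlib.Algebra.Module.ZLattice.Basic
import Mathlib.LinearAlgebra.Dimension.Basic
import Mathlib.LinearAlgebra.LinearIndependent.Lemmas
import Mathlib.RingTheory.Noetherian.Basic
import Literature.NumberTheory.DiophantineGeometry.AVIsogenyTate
import Literature.AlgebraicGeometry.Motives.AbelianVarietyProduct
import Literature.AlgebraicGeometry.Motives.AbelianVarietyBaseChange
import Mathlib.AlgebraicGeometry.Sites.Fpqc
import Mathlib.RingTheory.RingHom.FaithfullyFlat
import HarnessLib

/-!
# Towards `Hom(A, B)` finitely generated (Mumford §19, Theorem 3): the formal steps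

Sibling proof file of `Literature/NumberTheory/DiophantineGeometry/AVIsogenyTate.lean`, which
records as a named fact

* `Literature.AlgebraicGeometry.Motives.AbelianVariety.module_finite_hom A B : Prop` — for
  abelian varieties `A`, `B` over a field `K`, `Hom(A, B)` is a finitely generated abelian group
  (Mumford, *Abelian Varieties*, §19, Theorem 3; Milne 1986, Theorem 12.5).

The printed proof (Mumford §19, pp. 176–178; Milne 1986, §12, PDF pp. 189–191 of the held copy
of Cornell–Silverman) has three steps:

1. for every finitely generated subgroup `M ≤ Hom(X, Y)` its saturation
   `ℚM ∩ Hom(X, Y) = {f | n f ∈ M for some n ≠ 0}` is finitely generated — by Poincaré's complete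
   reducibility one reduces to `X`, `Y` simple, where every non-zero homomorphism is an isogeny and
   the degree, a homogeneous polynomial function of degree `2 dim X` on `ℚM` (Mumford §19 Thm. 2,
   Milne Prop. 12.4), is a positive integer on the non-zero points of the saturation, which is
   therefore discrete in `ℝM`, hence finitely generated (Milne, proof of Lemma 12.7, (*));
2. for `M` finitely generated and saturated, `ℤ_ℓ ⊗ M → Hom(T_ℓ X, T_ℓ Y)` is injective
   (`T_ℓ f ≡ 0 mod ℓ` forces `ℓ ∣ f`, Milne Lemma 12.6), so `rank M ≤ 4 dim X dim Y`;
3. the ranks of finitely generated subgroups being bounded, `Hom(X, Y)` is the saturation of one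
   of them, hence finitely generated by step 1.

The geometric inputs of step 1 (Poincaré reducibility, the degree as a polynomial function,
non-zero homomorphisms between simple abelian varieties are isogenies) are not in the tree; the
inputs of step 2 are in the sibling proof files `AVIsogenyTateInjectiveProofs` (Milne Lemma 12.6,
`exists_eq_pow_smul_of_tateModuleMap_eq`, and the `ℓ`-adic argument
`PadicInt.injective_of_forall_exists_eq_pow_smul`), `AVIsogenyTateFinrankHomProofs` (rank
bookkeeping along the Tate map) and `AVGaloisModuleTateRankProofs` (`T_ℓ A ≅ ℤ_ℓ^{2 dim A}` from
the torsion counts); torsion-freeness of `Hom(A, B)` is in `AVIsogenyTateFreeHomProofs`. This file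
proves the remaining *formal* parts, as real theorems with no new named facts and no new
definitions:

* `module_finite_int_of_rank_le_of_exists_fg` — step 3 for an arbitrary abelian group:
  bounded rank + every finitely generated subgroup has its saturation inside a finitely generated
  subgroup ⇒ finitely generated;
* `fg_of_norm` — the discreteness argument of step 1 (Milne, proof of Lemma 12.7) for an
  arbitrary torsion-free abelian group `H`: if `S ≤ H` lies in the saturation of a subgroup `M`
  with a finite basis, and an integer-valued function `N` on `S` is `≥ 1` off `0` and is given, in
  the rational coordinates with respect to the basis, by a continuous real function `F` with
  `F 0 < 1`, then `S` is finitely generated (its coordinate image is a discrete subgroup of `ℝ^ι`;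
  Mathlib `instModuleFinite_of_discrete_submodule`);
* `AbelianVariety.module_finite_hom_of_module_finite_end_biprod` — `Hom(A, B)` is a direct summand
  of `End(A × B)`, so it suffices to treat endomorphism rings (Milne, proof of Thm. 12.5);
* `AbelianVariety.Hom.baseChange_injective` — base change of homomorphisms along a field
  extension `L / K` is injective (the projection `A_L → A` is flat, surjective and quasi-compact,
  hence an epimorphism of schemes — Mathlib's fpqc effective epimorphisms), so that
  `Hom_K(A, B)` is finitely generated as soon as `Hom_L(A_L, B_L)` is
  (`AbelianVariety.module_finite_hom_of_baseChange`): Mumford works over an algebraically closed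
  field, and this is the reduction of the general statement (Milne 1986, Thm. 12.5) to that case;
* `AbelianVariety.module_finite_hom_of_rank_le_of_exists_fg` — step 3 for `Hom(A, B)`: the
  named fact `module_finite_hom A B` follows from a rank bound and step 1.

The sequel `AVIsogenyTateHomStepIIProofs` proves step 2 for saturated finitely generated `M` and
assembles: `module_finite_hom A B` follows from step 1 and the torsion counts
`natCard_torsionPoints_of_isAlgClosed` of `A` and `B`.

## References

* [MumfordAV1970] D. Mumford, *Abelian Varieties*, §19, Theorem 3 and its proof (pp. 176–178 of
  the 2nd ed.), Theorems 1–2 (pp. 173–176). Not held; architecture as in Milne 1986.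
* [Milne1986AbelianVarieties] J. S. Milne, *Abelian Varieties*, in Cornell–Silverman (eds.),
  *Arithmetic Geometry*, Springer 1986, §12: Lemma 12.2, Prop. 12.4, Thm. 12.5, Lemmas 12.6–12.7
  (held: `book:cornellnd-arithmetic-geometry`, PDF pp. 189–191).

## Design

No definitions are introduced. "`S` lies in the saturation `ℚM ∩ H` of `M`" is spelled
`∀ x ∈ S, ∃ n : ℤ, n ≠ 0 ∧ n • x ∈ M` (Mumford: "`{φ | nφ ∈ M, some n ≠ 0}`"), which avoids the
quotient `H ⧸ M` and its two `ℤ`-module structures; the embedding `Hom(A, B) → End(A ⊞ B)` is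
the explicit `f ↦ biprod.fst ≫ f ≫ biprod.inr` for Mathlib's biproduct (`AbelianVariety K` has
binary biproducts, `Literature.AlgebraicGeometry.Motives.AbelianVariety.hasBinaryBiproducts_inst`).
-/

universe u

open CategoryTheory CategoryTheory.Limits

noncomputable section

namespace Literature.NumberTheory.DiophantineGeometry

/-! ### Saturations of subgroups: two lemmas on abstract abelian groups -/

section Saturation

variable {H : Type*} [AddCommGroup H]

/-- **Step 3 of Mumford's proof of §19 Thm. 3, for an abstract abelian group.** If the ranks of
the finitely generated subgroups of `H` are bounded (here: `rank_ℤ H ≤ N`, Mathlib's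
`Module.rank`, the supremum of the cardinalities of the linearly independent subsets) and the
saturation `{x | n • x ∈ M for some n ≠ 0}` of every finitely generated subgroup `M` lies in a
finitely generated subgroup, then `H` is finitely generated: a maximal linearly independent subset
`s` is finite, and every `x ∈ H` has `n • x ∈ ℤs` for some `n ≠ 0` (maximality), so `H` is the
saturation of the finitely generated `ℤs`. (Mumford, *Abelian Varieties*, §19, end of the proof of
Theorem 3.) [cite: MumfordAV1970, §19 Thm. 3 (proof, last step)] -/
theorem module_finite_int_of_rank_le_of_exists_fg (N : ℕ) (hrank : Module.rank ℤ H ≤ N)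
    (hsat : ∀ M : Submodule ℤ H, M.FG →
      ∃ S : Submodule ℤ H, S.FG ∧ ∀ x : H, (∃ n : ℤ, n ≠ 0 ∧ n • x ∈ M) → x ∈ S) :
    Module.Finite ℤ H := by
  obtain ⟨s, hli, hmax⟩ := exists_maximal_linearIndepOn ℤ (id : H → H)
  have hfin : s.Finite := by
    rw [← Cardinal.lt_aleph0_iff_set_finite]
    exact (hli.linearIndependent.cardinal_le_rank.trans hrank).trans_lt
      (Cardinal.natCast_lt_aleph0 (n := N))
  obtain ⟨S, hSfg, hS⟩ := hsat (Submodule.span ℤ s) (Submodule.fg_span hfin)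
  have htop : S = ⊤ := by
    refine eq_top_iff.2 fun x _ => hS x ?_
    by_cases hx : x ∈ s
    · exact ⟨1, one_ne_zero, by rw [one_zsmul]; exact Submodule.subset_span hx⟩
    · obtain ⟨a, ha, hax⟩ := hmax x hx
      exact ⟨a, ha, by simpa [Set.image_id] using hax⟩
  refine ⟨?_⟩
  rw [← htop]
  exact hSfg

/-- Two ways of writing multiples of the same element of `H` in terms of a basis `b` of a
subgroup `M` have proportional coordinates: if `m • x = y` and `m' • x = y'` with `y, y' ∈ M`,
then `m' • b.repr y = m • b.repr y'` coordinatewise. [folklore] -/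
theorem repr_mul_eq_of_smul_eq {ι : Type*} {M : Submodule ℤ H} (b : Module.Basis ι ℤ M) {x : H}
    {m m' : ℤ} {y y' : M} (hy : m • x = y) (hy' : m' • x = y') (i : ι) :
    m' * b.repr y i = m * b.repr y' i := by
  have h : m' • y = m • y' := by
    apply Subtype.ext
    change m' • (y : H) = m • (y' : H)
    rw [← hy, ← hy', smul_smul, smul_smul, mul_comm]
  have := congrArg (fun z : M => b.repr z i) h
  simpa [map_zsmul, mul_comm] using this

/-- **The discreteness argument of Milne 1986, Lemma 12.7 / Mumford §19 Thm. 3, Step I, for an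
abstract torsion-free abelian group.** Let `M ≤ H` have a finite basis `b`, let `S ≤ H` lie in
the saturation of `M` (every `x ∈ S` has `m • x ∈ M` for some `m ≠ 0`), and let `N : H → ℤ` be a
function which is `≥ 1` at every non-zero element of `S` and which, in the rational coordinates
of `S` with respect to `b` (if `m • x = ∑ cᵢ bᵢ`, `m ≠ 0`, the coordinates of `x` are `cᵢ / m`),
is given by a continuous function `F : ℝ^ι → ℝ` with `F 0 < 1`. Then `S` is finitely generated.
Proof as printed: the coordinate map embeds `S` into `ℝ^ι` as a subgroup meeting the open
neighbourhood `{F < 1}` of `0` only in `0`, hence a discrete subgroup of a finite-dimensional real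
vector space, hence finitely generated (Mathlib `instModuleFinite_of_discrete_submodule`). In the
source `H = End(A)` for a simple abelian variety `A`, `S = ℚM ∩ End(A)`, `N = deg` and `F` is
the polynomial of Mumford §19 Thm. 2 / Milne Prop. 12.4.
[cite: Milne1986AbelianVarieties, Lemma 12.7 (proof, statement (*), PDF p. 191)] -/
theorem fg_of_norm [NoZeroSMulDivisors ℤ H] {ι : Type*} [Fintype ι] (M S : Submodule ℤ H)
    (b : Module.Basis ι ℤ M) (hS : ∀ x ∈ S, ∃ n : ℤ, n ≠ 0 ∧ n • x ∈ M) (N : H → ℤ)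
    (F : (ι → ℝ) → ℝ) (hF : Continuous F) (hF0 : F 0 < 1) (hN : ∀ x ∈ S, x ≠ 0 → 1 ≤ N x)
    (hNF : ∀ x ∈ S, ∀ (m : ℤ) (y : M), m ≠ 0 → m • x = y →
      (N x : ℝ) = F (fun i => (b.repr y i : ℝ) / m)) :
    S.FG := by
  -- every element of `S` has a non-zero multiple in `M`; choose one
  have key : ∀ x : S, ∃ p : ℤ × M, p.1 ≠ 0 ∧ p.1 • (x : H) = p.2 := fun x => by
    obtain ⟨n, hn, h⟩ := hS x x.2
    exact ⟨⟨n, ⟨n • (x : H), h⟩⟩, hn, rfl⟩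
  choose p hp0 hp using key
  -- the coordinate map `q : S → ℝ^ι`
  let q : S → (ι → ℝ) := fun x i => (b.repr (p x).2 i : ℝ) / (p x).1
  have hq : ∀ (x : S) (m : ℤ) (y : M), m ≠ 0 → m • (x : H) = y →
      q x = fun i => (b.repr y i : ℝ) / m := fun x m y hm hy => by
    funext i
    have h := repr_mul_eq_of_smul_eq b (hp x) hy i
    have h' : ((m * b.repr (p x).2 i : ℤ) : ℝ) = ((p x).1 * b.repr y i : ℤ) := congrArg _ h
    push_cast at h'
    rw [div_eq_div_iff (Int.cast_ne_zero.2 (hp0 x)) (Int.cast_ne_zero.2 hm)]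
    linarith [h']
  have hq_add : ∀ x x' : S, q (x + x') = q x + q x' := fun x x' => by
    have hm : (p x).1 * (p x').1 ≠ 0 := mul_ne_zero (hp0 x) (hp0 x')
    have hsum : ((p x).1 * (p x').1) • ((x + x' : S) : H) =
        (((p x').1 • (p x).2 + (p x).1 • (p x').2 : M) : H) := by
      rw [Submodule.coe_add, Submodule.coe_add, Submodule.coe_smul, Submodule.coe_smul, ← hp x,
        ← hp x', smul_add, smul_smul, smul_smul, mul_comm (p x).1 (p x').1]
    rw [hq (x + x') _ _ hm hsum]
    funext i
    have h1 : ((p x).1 : ℝ) ≠ 0 := Int.cast_ne_zero.2 (hp0 x)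
    have h2 : ((p x').1 : ℝ) ≠ 0 := Int.cast_ne_zero.2 (hp0 x')
    simp only [q, Pi.add_apply, map_add, map_zsmul, Finsupp.coe_add, Finsupp.coe_smul,
      Pi.smul_apply, smul_eq_mul, Int.cast_mul, Int.cast_add]
    field_simp
  let qHom : S →ₗ[ℤ] (ι → ℝ) := (AddMonoidHom.mk' q hq_add).toIntLinearMap
  have hqHom : ∀ x : S, qHom x = q x := fun _ => rfl
  -- `q` is injective (`H` is torsion-free)
  have hq_inj : Function.Injective qHom := by
    rw [injective_iff_map_eq_zero]
    intro x hx
    rw [hqHom] at hx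
    have hrepr : b.repr (p x).2 = 0 := by
      ext i
      have := congrFun hx i
      simp only [q, Pi.zero_apply, div_eq_zero_iff, Int.cast_eq_zero] at this
      exact this.resolve_right (hp0 x)
    have h2 : (p x).2 = 0 := b.repr.injective (by rw [hrepr, map_zero])
    have h3 : (p x).1 • (x : H) = 0 := by rw [hp x, h2, Submodule.coe_zero]
    exact Subtype.ext ((smul_eq_zero.1 h3).resolve_left (hp0 x))
  -- `N = F ∘ q` on `S`, so `F ≥ 1` on `q(S) ∖ {0}`
  have hNq : ∀ x : S, (N x : ℝ) = F (qHom x) := fun x => by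
    rw [hqHom, hq x _ _ (hp0 x) (hp x)]
    exact hNF x x.2 _ _ (hp0 x) (hp x)
  -- the image is a discrete subgroup of `ℝ^ι`
  let L : Submodule ℤ (ι → ℝ) := LinearMap.range qHom
  haveI : DiscreteTopology L := by
    refine discreteTopology_of_isOpen_singleton_zero ?_
    have hU : IsOpen ((Subtype.val : L → ι → ℝ) ⁻¹' (F ⁻¹' Set.Iio 1)) :=
      (hF.isOpen_preimage _ isOpen_Iio).preimage continuous_subtype_val
    convert hU using 1
    ext ⟨z, hz⟩
    simp only [Set.mem_singleton_iff, Set.mem_preimage, Set.mem_Iio]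
    constructor
    · intro h
      rw [Subtype.ext_iff] at h
      change z = 0 at h
      rw [h]
      exact hF0
    · intro h
      obtain ⟨x, rfl⟩ := LinearMap.mem_range.1 hz
      by_contra hne
      have hx0 : (x : H) ≠ 0 := by
        intro h'
        apply hne
        have hx : x = 0 := Subtype.ext h'
        subst hx
        exact Subtype.ext (map_zero qHom)
      have h1 : (1 : ℝ) ≤ N x := by exact_mod_cast hN x x.2 hx0
      rw [hNq x] at h1
      exact absurd h (not_lt.2 h1)
  haveI : Module.Finite ℤ L := instModuleFinite_of_discrete_submodule L
  have e : S ≃ₗ[ℤ] L := LinearEquiv.ofInjective qHom hq_inj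
  exact Module.Finite.iff_fg.1 (Module.Finite.equiv e.symm)

end Saturation

/-! ### Abelian varieties -/

section AbelianVariety
open Literature.AlgebraicGeometry.Motives (AbelianVariety)
open Literature.AlgebraicGeometry.Motives.AbelianVariety

variable {K : Type u} [Field K] {A B : AbelianVariety K}

/-- **`Hom(A, B)` is a direct summand of `End(A × B)`**: the map
`f ↦ pr₁ ≫ f ≫ in₂ : Hom(A, B) → End(A ⊞ B)` has the left inverse `g ↦ in₁ ≫ g ≫ pr₂`
(Milne 1986, proof of Thm. 12.5: "Hom(A, B) and Hom(T_ℓ A, T_ℓ B) are direct summands of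
End(A × B) and End(T_ℓ(A × B))"). [cite: Milne1986AbelianVarieties, Thm. 12.5 (proof, PDF p. 191)] -/
theorem _root_.Literature.AlgebraicGeometry.Motives.AbelianVariety.biprod_inl_comp_comp_snd
    (f : A ⟶ B) :
    (biprod.inl : A ⟶ A ⊞ B) ≫ ((biprod.fst : A ⊞ B ⟶ A) ≫ f ≫ (biprod.inr : B ⟶ A ⊞ B)) ≫
      (biprod.snd : A ⊞ B ⟶ B) = f := by
  simp

/-- **`Hom(A, B)` is finitely generated as soon as `End(A × B)` is** (Milne 1986, proof of
Thm. 12.5, reduction to `A = B`): `f ↦ pr₁ ≫ f ≫ in₂` is an injective `ℤ`-linear map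
`Hom(A, B) → End(A ⊞ B)` and `ℤ` is noetherian. [cite: Milne1986AbelianVarieties, Thm. 12.5 (proof, PDF p. 191)] -/
theorem _root_.Literature.AlgebraicGeometry.Motives.AbelianVariety.module_finite_hom_of_module_finite_end_biprod
    (h : Module.Finite ℤ (A ⊞ B ⟶ A ⊞ B)) : Module.Finite ℤ (A ⟶ B) := by
  let φ : (A ⟶ B) →ₗ[ℤ] (A ⊞ B ⟶ A ⊞ B) :=
    { toFun := fun f => (biprod.fst : A ⊞ B ⟶ A) ≫ f ≫ (biprod.inr : B ⟶ A ⊞ B)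
      map_add' := fun f g => by
        rw [Preadditive.add_comp, Preadditive.comp_add]
      map_smul' := fun n f => by
        rw [Preadditive.zsmul_comp, Preadditive.comp_zsmul, RingHom.id_apply] }
  have hφ : Function.Injective φ := fun f g hfg => by
    rw [← AbelianVariety.biprod_inl_comp_comp_snd f, ← AbelianVariety.biprod_inl_comp_comp_snd g]
    exact congrArg (fun e => (biprod.inl : A ⟶ A ⊞ B) ≫ e ≫ (biprod.snd : A ⊞ B ⟶ B)) hfg
  exact Module.Finite.of_injective φ hφ

section BaseChange
open _root_.AlgebraicGeometry

variable (L : Type u) [Field L] [Algebra K L]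

/-- **Base change of homomorphisms along a field extension is injective**: if `f_L = g_L` then
`f = g`. The projection `A_L = A ×_K L → A` is the base change of `Spec L → Spec K`, which is
flat and surjective (`L` is faithfully flat over the field `K`), and it is quasi-compact; so it is
an (effective) epimorphism of schemes (faithfully flat descent of morphisms; Mathlib,
`AlgebraicGeometry.Sites.Fpqc`), and `pr ≫ f = f_L ≫ pr = g_L ≫ pr = pr ≫ g` gives `f = g`.
[folklore] -/
theorem _root_.Literature.AlgebraicGeometry.Motives.AbelianVariety.Hom.baseChange_injective :
    Function.Injective (Hom.baseChange (A := A) (B := B) L) := by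
  intro f g hfg
  have h2 : pullback.fst A.X.hom (bcSpec K L) ≫ Hom.toSchemeHom f =
      pullback.fst A.X.hom (bcSpec K L) ≫ Hom.toSchemeHom g := by
    rw [← toSchemeHom_baseChange_comp_fst, hfg, toSchemeHom_baseChange_comp_fst]
  have hff : (CommRingCat.ofHom (algebraMap K L)).hom.FaithfullyFlat := by
    rw [CommRingCat.hom_ofHom, RingHom.faithfullyFlat_algebraMap_iff]
    infer_instance
  obtain ⟨hflat, hsurj⟩ := (flat_and_surjective_SpecMap_iff _).2 hff
  haveI : Flat (pullback.fst A.X.hom (bcSpec K L)) := MorphismProperty.pullback_fst _ _ hflat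
  haveI : Surjective (pullback.fst A.X.hom (bcSpec K L)) :=
    MorphismProperty.pullback_fst _ _ hsurj
  haveI : QuasiCompact (pullback.fst A.X.hom (bcSpec K L)) :=
    MorphismProperty.pullback_fst _ _ inferInstance
  exact hom_ext _ _ (Over.OverMorphism.ext ((cancel_epi _).1 h2))

/-- **`Hom_K(A, B)` is finitely generated as soon as `Hom_L(A_L, B_L)` is**, for a field
extension `L / K`: `f ↦ f_L` is an injective (`Hom.baseChange_injective`) additive map, and `ℤ` is
noetherian. With `L = K̄` this reduces Milne 1986, Thm. 12.5 (arbitrary base field) to Mumford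
§19, Thm. 3 (algebraically closed base field). [cite: Milne1986AbelianVarieties, Thm. 12.5 (PDF p. 190)] -/
theorem _root_.Literature.AlgebraicGeometry.Motives.AbelianVariety.module_finite_hom_of_baseChange
    (h : Module.Finite ℤ (A.baseChange L ⟶ B.baseChange L)) : Module.Finite ℤ (A ⟶ B) := by
  haveI := h
  let φ : (A ⟶ B) →+ (A.baseChange L ⟶ B.baseChange L) := (baseChangeFunctor K L).mapAddHom
  exact Module.Finite.of_injective φ.toIntLinearMap fun f g hfg => Hom.baseChange_injective L hfg

end BaseChange

variable (A B) in
/-- **Mumford's reduction of the finite generation of `Hom(A, B)` to the saturation lemma and the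
rank bound** (§19, proof of Thm. 3, last step): if `rank_ℤ Hom(A, B) ≤ N` (in the source
`N = 4 dim A dim B`, from the injectivity of `ℤ_ℓ ⊗ M → Hom(T_ℓ A, T_ℓ B)` on saturated finitely
generated `M`) and the saturation `ℚM ∩ Hom(A, B)` of every finitely generated `M ≤ Hom(A, B)`
lies in a finitely generated subgroup (Step I of the printed proof), then the named fact
`module_finite_hom A B` holds. [cite: MumfordAV1970, §19 Thm. 3 (proof, last step)] -/
theorem _root_.Literature.AlgebraicGeometry.Motives.AbelianVariety.module_finite_hom_of_rank_le_of_exists_fg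
    (N : ℕ) (hrank : Module.rank ℤ (A ⟶ B) ≤ N)
    (hsat : ∀ M : Submodule ℤ (A ⟶ B), M.FG →
      ∃ S : Submodule ℤ (A ⟶ B), S.FG ∧ ∀ f : A ⟶ B, (∃ n : ℤ, n ≠ 0 ∧ n • f ∈ M) → f ∈ S) :
    module_finite_hom A B :=
  module_finite_int_of_rank_le_of_exists_fg N hrank hsat

end AbelianVariety

end Literature.NumberTheory.DiophantineGeometry
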